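import Literature.Computability.Cryptography.QuantumTuringMachineCircuitSemantics
import Literature.Computability.Cryptography.QuantumTuringMachineCircuitUniform
import Literature.Computability.QuantumComplexity.QuantumTuring
import Literature.Computability.QuantumComplexity.BQP
import Literature.Computability.QuantumComplexity.CliffordTUniversalityProofs
import Literature.Computability.QuantumComplexity.JonesInBQPProofs
import HarnessLib

/-!
# `BQPQTM ⊆ BQP` modulo gate-set independence (Nishimura–Ozawa 2002, Thm. 4.3 ⇒ Thm. 5.2, one direction)

The assembly of the head-centred simulation of quantum Turing machines (files
`Cryptography/QuantumTuringMachineHeadCentred*.lean`, `…CodedGates.lean`, `…CircuitLayout.lean`,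
`…CircuitSemantics.lean`, `…CircuitUniform.lean`): for every well-formed QTM `M` with polynomial-time computable
amplitudes and every polynomial `p`, the family `hcFamily M p` over the finite gate set `𝒢_M` is oracle-free, uniform,
and has exactly the acceptance probabilities `acceptProbAt M x (p |x|)` of the tree's `BQPQTM` (translation-invariant
quotient semantics, halting ignored, acceptance read at time `p(|x|)`). Hence

* `mem_BQPOver_hcGateSet`, `exists_mem_BQPOver_of_mem_BQPQTM` — `BQPQTM ⊆ ⋃_M BQPOver 𝒢_M` (proved outright);
* `BQPQTM_subset_BQP_of_gateSetIndependence` — **`BQPOver_eq_BQP → BQPQTM ⊆ BQP`**: the only remaining ingredient for this direction is the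
  named fact `BQPOver_eq_BQP` (`QuantumComplexity/BQP.lean`: gate-set independence of `BQP` for finite universal
  inverse-closed gate sets with polynomial-time computable entries — the effective Solovay–Kitaev theorem), whose four
  hypotheses are discharged for `𝒢_M` here (`hcGateSet_isUnitary`, `hcGateSet_isUniversal` — via `GeneratesDenselyModPhase.mono` —, `hcGateSet_isInverseClosed`,
  `hcGateSet_polyTime`);
* `BQPQTM_eq_BQP_of_gateSetIndependence` — the target fact `BQPQTM_eq_BQP` from `BQPOver_eq_BQP` and the converse
  inclusion `BQP ⊆ BQPQTM` (Nishimura–Ozawa 2002, Thm. 5.2 via Lemma 4.4, not formalised).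

No new named facts are introduced.

## References

* H. Nishimura, M. Ozawa, *Computational complexity of uniform quantum circuit families and quantum Turing
  machines*, Theoret. Comput. Sci. 276 (2002) 147–181 [NishimuraOzawa2002], §3 (Lemma 3.2), §4 (Prop. 4.2, Thm. 4.3,
  Lemma 4.4), §5 (Thm. 5.2).
* E. Bernstein, U. Vazirani, *Quantum complexity theory*, SIAM J. Comput. 26 (1997) [BernsteinVazirani1997SICOMP], §8.
* A. Yao, *Quantum circuit complexity*, FOCS 1993 [Yao1993].
* C. M. Dawson, M. A. Nielsen, *The Solovay–Kitaev algorithm*, QIC 6 (2006) [DawsonNielsen2006].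
-/

noncomputable section

namespace Literature.Computability.QuantumComplexity

open Cryptography Complexity

/-- **`𝒢_M` is universal**: it contains the placements of Clifford+`T`, which are universal (`cliffordT_isUniversal_holds`, Nielsen–Chuang 2010, §4.5.3). [cite: NielsenChuang2010, §4.5.3] -/
theorem hcGateSet_isUniversal (M : QTM) : M.hcGateSet.IsUniversal := by
  obtain ⟨n₀, hn₀⟩ := cliffordT_isUniversal_holds
  exact ⟨n₀, fun n hn => GeneratesDenselyModPhase.mono (M.placements_cliffordT_subset n) (hn₀ n hn)⟩

/-- **A language decided by a well-formed QTM with error `≤ 1/3` in polynomial time `p` is in `BQPOver 𝒢_M`**, witnessed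
by the simulating family `hcFamily M p` (oracle-free, uniform, and with exactly the machine's acceptance probabilities:
`acceptProbOn_hcFamily`). This is Nishimura–Ozawa 2002, Thm. 4.3/Thm. 5.2 (`BQP ⊆ BUPQC` direction) in the tree's
semantics, over the machine's own finite gate set. [cite: NishimuraOzawa2002, Thm. 4.3, Thm. 5.2] -/
theorem mem_BQPOver_hcGateSet {L : Language Bool} {M : QTM} {p : Polynomial ℕ} (hwf : M.IsWellFormed)
    (hL : ∀ x : List Bool, (x ∈ L → (2 / 3 : ℝ) ≤ M.acceptProbAt x (p.eval x.length)) ∧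
      (x ∉ L → M.acceptProbAt x (p.eval x.length) ≤ (1 / 3 : ℝ))) :
    L ∈ BQPOver M.hcGateSet := by
  refine ⟨M.hcFamily p, M.hcFamily_isOracleFree p, M.hcFamily_isUniform p, fun x => ?_⟩
  rw [M.acceptProbOn_hcFamily p hwf x]
  refine ⟨fun hx => ?_, fun hx => (hL x).2 hx⟩
  have := (hL x).1 hx
  change (1 : ℝ) - 1 / 3 ≤ M.acceptProbAt x (p.eval x.length)
  linarith

/-- Every `BQPQTM` language lies in `BQPOver 𝒢_M` for a well-formed `M` with polynomial-time computable amplitudes. [cite: NishimuraOzawa2002, Thm. 5.2] -/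
theorem exists_mem_BQPOver_of_mem_BQPQTM {L : Language Bool} (hL : L ∈ BQPQTM) :
    ∃ M : QTM, M.IsWellFormed ∧ M.amplitudes ⊆ polyTimeComputableComplex ∧ L ∈ BQPOver M.hcGateSet := by
  obtain ⟨M, p, hwf, hamp, hL⟩ := hL
  exact ⟨M, hwf, hamp, mem_BQPOver_hcGateSet hwf hL⟩

/-- **`BQPQTM ⊆ BQP`, given gate-set independence of `BQP`.** The simulating family lives over the finite gate set
`𝒢_M = cliffordT ⊕ HCOp` (unitary, universal, inverse-closed, polynomial-time computable entries — exactly the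
hypotheses of the named fact `BQPOver_eq_BQP`, the effective Solovay–Kitaev theorem, Dawson–Nielsen 2006 / Kitaev 1997),
so `BQPOver 𝒢_M = BQP` transports the witness to Clifford+`T`. Nishimura–Ozawa 2002 use the same two ingredients
(Thm. 4.3: exact simulation by a uniform family over a machine-dependent finite gate set with `PC` entries; §3,
Lemma 3.2/Prop. 4.2: polynomial-time approximation of `PC`-gates over a fixed universal set). [cite: NishimuraOzawa2002, Thm. 4.3, Thm. 5.2] -/
theorem BQPQTM_subset_BQP_of_gateSetIndependence (h : BQPOver_eq_BQP) : BQPQTM ⊆ BQP := by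
  intro L hL
  obtain ⟨M, hwf, hamp, hmem⟩ := exists_mem_BQPOver_of_mem_BQPQTM hL
  rw [← h M.hcGateSet (M.hcGateSet_isUnitary hwf) (hcGateSet_isUniversal M) (M.hcGateSet_isInverseClosed hwf)
    (M.hcGateSet_polyTime hamp)]
  exact hmem

/-- **`BQPQTM = BQP` from gate-set independence and the converse simulation.** The converse inclusion `BQP ⊆ BQPQTM`
(Nishimura–Ozawa 2002, Thm. 5.2 via Yao 1993 / their Lemma 4.4: a uniform circuit family is simulated by a single
well-formed QTM with `PC` amplitudes) is the remaining hypothesis `hNO`; with it and `BQPOver_eq_BQP` the named fact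
`BQPQTM_eq_BQP` of `QuantumComplexity/QuantumTuring.lean` follows. [cite: NishimuraOzawa2002, Thm. 5.2] -/
theorem BQPQTM_eq_BQP_of_gateSetIndependence (h : BQPOver_eq_BQP) (hNO : BQP ⊆ BQPQTM) : BQPQTM_eq_BQP :=
  Set.Subset.antisymm (BQPQTM_subset_BQP_of_gateSetIndependence h) hNO

end Literature.Computability.QuantumComplexity

end
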